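import Summits.NavierStokesRegularity.NavierStokesRegularity.Theorems.ScenarioCensusSubgridMeterLaws
import HarnessLib

/-!
# LINE «subgrid-meter» port, part 3/3: calibration II — the large-scale law (§K), the rows (§I) and verdicts (§J); census KEYS `Row_A2kp` / `Row_A2k1` / `Row_A2kb` / `Row_A2k0` /
# `Row_A2kf` / `Row_A2kl` + `_excluded`, `Row_A2kP` / `Row_A2kU` (OPEN)

Re-homed for the scenario census (typer seat ns-census-typer-1 g8; cells of ns-idea-2 g15 LINE «subgrid-meter» dceda87d33ef0baf, critic idea-crit-3 g8 verdict 05:34Z,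
members OF RECORD since census v1.84; this port makes the decided cells TREE-decided): VERBATIM PORT of `pub/ideators/ns-idea-2/lines/subgrid-meter/line-subgrid-meter.lean`
sha16 dceda87d33ef0baf (743 l., lean check rc 0, 0 sorry), split for the 400-line rule into `ScenarioCensusSubgridMeter` (§A–§E) → `…SubgridMeterLaws` (§F–§H) →
`…SubgridMeterRows` (§K, §I–§J + census KEYS).  Lean text VERBATIM in namespace `…Theorems.ScenarioCensus.SubgridMeter` (the line's `…Lines.SubgridMeter` re-homed);
port edits: `local notation "E3"` → `abbrev E3` (typer lint: no notation in port files), `@[conjecture]` on the OPEN rows `Row_A2kP` / `Row_A2kU` (typed only), one-line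
docstrings added where missing (gate lint); the coordinate bound `norm_apply_le_norm` (`‖v i‖ ≤ ‖v‖`, twin of landed tree lemmas) is not re-declared — its uses are
Mathlib's `PiLp.norm_apply_le` (proof text only).  Statements untouched.

No census VALUE is moved here (the cells become TREE-decided by name; booking is the lead's); NS regularity is NOT proved; (L′) ⟨10661⟩ is untouched; no summit
statement is proved by this file. Lemmas that restate already-landed tree declarations are taken BY NAME (gate lint `dedup.landed`): `norm_apply_le_norm` = `PiLp.norm_apply_le`.
-/

-- the summit and its single problem share the name `NavierStokesRegularity` (D-0017 nested layout)
set_option linter.dupNamespace false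

noncomputable section

open Set Function Filter Topology Metric MeasureTheory
open scoped RealInnerProductSpace ENNReal NNReal

namespace Summit.NavierStokesRegularity.NavierStokesRegularity.Theorems.ScenarioCensus.SubgridMeter

open Literature.Analysis Literature.Analysis.FluidPDE Literature.Analysis.UnboundedOperators
open Summit.NavierStokesRegularity.NavierStokesRegularity.Theorems
open Summit.NavierStokesRegularity.NavierStokesRegularity.Theorems.BlobRiccatiClosure.TypeIApexLiouville
  (stub_typeIGaugeBounds)
open Summit.NavierStokesRegularity.NavierStokesRegularity.Theorems.SymmetryModuliCountSymmetricLiouville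
  (vanishes_of_vanishes_before)

/-! ## K. Calibration II — the large-scale law (far-past ledger against the Gaussian) -/

/-- The ledger `∫_{B_1(z)} ‖u(t)‖² ≤ K(C)` for every `u ∈ A_C`, `t < 0`, `z`, as an `ℝ≥0∞` bound
on `∫⁻ ‖u t‖ₑ²` over unit balls (`FarPastLedger_proof`, ⟨14060⟩, at `R = 1`; verbatim from the
g15-1 line «diffusion-meter»). -/
theorem ledger_unitBall (C : ℝ) : ∃ K : ℝ, 0 ≤ K ∧ ∀ u : ℝ → E3 → E3, IsTypeIAncientMild C u →
    ∀ t < 0, ∀ z : E3, ∫⁻ y in ball z 1, ‖u t y‖ₑ ^ 2 ≤ ENNReal.ofReal K := by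
  obtain ⟨K, hK⟩ := FarPastLedger_proof C
  refine ⟨max K 0, le_max_right _ _, fun u hu t ht z => ?_⟩
  have h1 : ∫ y in ball z 1, ‖u t y‖ ^ 2 ≤ K * 1 := hK u hu t ht z 1 one_pos
  have hcont : Continuous (u t) := hu.continuous_slice ht
  have hint : IntegrableOn (fun y => ‖u t y‖ ^ 2) (ball z 1) := by
    refine Measure.integrableOn_of_bounded (M := (C / Real.sqrt (-t)) ^ 2) measure_ball_lt_top.ne
      ((hcont.norm.pow 2).aestronglyMeasurable) ?_
    refine (ae_restrict_iff' measurableSet_ball).2 (Eventually.of_forall fun y _ => ?_)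
    rw [Real.norm_of_nonneg (by positivity)]
    exact pow_le_pow_left₀ (norm_nonneg _) (hu.norm_le ht y) 2
  have heq : ∫⁻ y in ball z 1, ‖u t y‖ₑ ^ 2 = ENNReal.ofReal (∫ y in ball z 1, ‖u t y‖ ^ 2) := by
    rw [ofReal_integral_eq_lintegral_ofReal hint (Eventually.of_forall fun y => by positivity)]
    refine lintegral_congr fun y => ?_
    rw [← ofReal_norm, ← ENNReal.ofReal_pow (norm_nonneg _)]
  rw [heq]
  exact ENNReal.ofReal_le_ofReal (by linarith [le_max_left K 0])

/-- `G₁(y) ≤ 98304 (1 + |y|)⁻⁴` on all of `ℝ³` (verbatim from «diffusion-meter»; twin of the tree's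
`heatKernel_le_inv_one_add_norm_pow_four`). -/
theorem heatKernel_one_le_weight (y : E3) : heatKernel 1 y ≤ 98304 * ((1 + ‖y‖) ^ 4)⁻¹ := by
  set r : ℝ := ‖y‖ with hr
  have hr0 : 0 ≤ r := norm_nonneg y
  have hpre : (4 * Real.pi * (1 : ℝ)) ^ (-(3 : ℝ) / 2) ≤ 1 :=
    Real.rpow_le_one_of_one_le_of_nonpos (by nlinarith [Real.pi_gt_three]) (by norm_num)
  have hexp1 : Real.exp (-(1 / (4 * (1 : ℝ))) * r ^ 2) ≤ 1 := by
    rw [Real.exp_le_one_iff]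
    nlinarith [sq_nonneg r]
  have hG : heatKernel 1 y ≤ Real.exp (-(1 / (4 * (1 : ℝ))) * r ^ 2) := by
    rw [heatKernel_eq, finrank_euclideanSpace_fin]
    push_cast
    exact mul_le_of_le_one_left (Real.exp_pos _).le hpre
  have h14 : 0 < (1 + r) ^ 4 := by positivity
  by_cases hy : 1 ≤ r
  · set u : ℝ := r ^ 2 / 4 with hu
    have hu0 : 0 < u := by rw [hu]; positivity
    have hfac : u ^ 4 / 24 ≤ Real.exp u := by
      have := Real.pow_div_factorial_le_exp u hu0.le 4
      norm_num [Nat.factorial] at this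
      exact this
    have hexp : Real.exp (-(1 / (4 * (1 : ℝ))) * r ^ 2) ≤ 24 / u ^ 4 := by
      have e1 : -(1 / (4 * (1 : ℝ))) * r ^ 2 = -u := by rw [hu]; ring
      rw [e1, Real.exp_neg, le_div_iff₀ (by positivity)]
      rw [div_le_iff₀ (by norm_num : (0:ℝ) < 24)] at hfac
      calc (Real.exp u)⁻¹ * u ^ 4 = u ^ 4 / Real.exp u := by rw [div_eq_mul_inv, mul_comm]
        _ ≤ 24 := by rw [div_le_iff₀ (Real.exp_pos u)]; linarith
    have hr4 : 1 ≤ r ^ 4 := one_le_pow₀ hy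
    have hu4 : u ^ 4 = r ^ 4 * r ^ 4 / 256 := by rw [hu]; ring
    have h1r : (1 + r) ^ 4 ≤ 16 * r ^ 4 := by
      have : 1 + r ≤ 2 * r := by linarith
      calc (1 + r) ^ 4 ≤ (2 * r) ^ 4 := pow_le_pow_left₀ (by positivity) this 4
        _ = 16 * r ^ 4 := by ring
    have hr4pos : 0 < r ^ 4 := by positivity
    calc heatKernel 1 y ≤ Real.exp (-(1 / (4 * (1 : ℝ))) * r ^ 2) := hG
      _ ≤ 24 / u ^ 4 := hexp
      _ = 6144 / (r ^ 4 * r ^ 4) := by rw [hu4]; field_simp; ring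
      _ ≤ 6144 / (r ^ 4 * 1) := by gcongr
      _ ≤ 98304 * ((1 + r) ^ 4)⁻¹ := by
          rw [mul_one, ← div_eq_mul_inv, div_le_div_iff₀ hr4pos h14]
          nlinarith
  · push Not at hy
    have h2 : (1 + r) ^ 4 ≤ 2 ^ 4 := pow_le_pow_left₀ (by positivity) (by linarith) 4
    have h4 : (1 : ℝ) ≤ 98304 * ((1 + r) ^ 4)⁻¹ := by
      rw [← div_eq_mul_inv, le_div_iff₀ h14]
      linarith
    exact (hG.trans hexp1).trans h4

/-- **Unit-scale Gaussian energy of a uniformly-locally-`L²` field**: there is an absolute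
`C_g < ∞` with `∫ G₁(y)‖b(y)‖² dy ≤ C_g·A` whenever `∫_{B_1(z)}‖b‖² ≤ A` for all `z` (summation
against the weight `(1+|y|)⁻⁴`, `exists_lintegral_mul_inv_one_add_norm_pow_le`). -/
theorem exists_gauss_unit_sq_bound : ∃ Cg : ℝ≥0∞, Cg ≠ ⊤ ∧ ∀ b : E3 → E3,
    AEStronglyMeasurable b volume → ∀ A : ℝ≥0∞,
    (∀ z : E3, ∫⁻ y in ball z 1, ‖b y‖ₑ ^ 2 ≤ A) →
    ∫⁻ y, ‖heatKernel 1 y * ‖b y‖ ^ 2‖ₑ ≤ Cg * A := by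
  obtain ⟨Cw, hCwtop, hCw⟩ := exists_lintegral_mul_inv_one_add_norm_pow_le
  refine ⟨ENNReal.ofReal 98304 * Cw, ENNReal.mul_ne_top ENNReal.ofReal_ne_top hCwtop,
    fun b hb A hA => ?_⟩
  have hpt : ∀ y : E3, ‖heatKernel 1 y * ‖b y‖ ^ 2‖ₑ ≤
      ENNReal.ofReal 98304 * (‖b y‖ₑ ^ 2 * ENNReal.ofReal (((1 + ‖y - 0‖) ^ 4)⁻¹)) := fun y => by
    have hG : ‖heatKernel 1 y‖ₑ ≤ ENNReal.ofReal 98304 * ENNReal.ofReal (((1 + ‖y - 0‖) ^ 4)⁻¹) := by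
      rw [sub_zero, Real.enorm_eq_ofReal (heatKernel_pos one_pos y).le,
        ← ENNReal.ofReal_mul (by norm_num)]
      exact ENNReal.ofReal_le_ofReal (heatKernel_one_le_weight y)
    have hsq : ‖‖b y‖ ^ 2‖ₑ = ‖b y‖ₑ ^ 2 := by
      rw [Real.enorm_eq_ofReal (sq_nonneg _), ENNReal.ofReal_pow (norm_nonneg _), ofReal_norm]
    calc ‖heatKernel 1 y * ‖b y‖ ^ 2‖ₑ = ‖heatKernel 1 y‖ₑ * ‖b y‖ₑ ^ 2 := by
          rw [enorm_mul, hsq]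
      _ ≤ (ENNReal.ofReal 98304 * ENNReal.ofReal (((1 + ‖y - 0‖) ^ 4)⁻¹)) * ‖b y‖ₑ ^ 2 :=
          mul_le_mul' hG le_rfl
      _ = ENNReal.ofReal 98304 * (‖b y‖ₑ ^ 2 * ENNReal.ofReal (((1 + ‖y - 0‖) ^ 4)⁻¹)) := by ring
  calc ∫⁻ y, ‖heatKernel 1 y * ‖b y‖ ^ 2‖ₑ
      ≤ ∫⁻ y, ENNReal.ofReal 98304 * (‖b y‖ₑ ^ 2 * ENNReal.ofReal (((1 + ‖y - 0‖) ^ 4)⁻¹)) :=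
        lintegral_mono hpt
    _ = ENNReal.ofReal 98304 * ∫⁻ y, ‖b y‖ₑ ^ 2 * ENNReal.ofReal (((1 + ‖y - 0‖) ^ 4)⁻¹) :=
        lintegral_const_mul' _ _ ENNReal.ofReal_ne_top
    _ ≤ ENNReal.ofReal 98304 * (Cw * A) := by
        gcongr
        exact hCw (fun y => ‖b y‖ₑ ^ 2) (hb.enorm.pow_const 2) A hA 0
    _ = ENNReal.ofReal 98304 * Cw * A := (mul_assoc _ _ _).symm

/-- `Var_s[vᵢ](x) ≤ e^{sΔ}(|v|²)(x)`: drop the resolved part and compare the data pointwise. -/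
theorem cVar_apply_le_heatExtension_norm_sq {v : E3 → E3} (hv : Continuous v) {M : ℝ}
    (hM : ∀ z, ‖v z‖ ≤ M) {s : ℝ} (hs : 0 < s) (i : Fin 3) (x : E3) :
    cVar (fun y => v y i) s x ≤ heatExtension (fun y => ‖v y‖ ^ 2) s x := by
  have hM0 : 0 ≤ M := (norm_nonneg _).trans (hM 0)
  have hsq : heatExtension (fun y => v y i ^ 2) s x ≤ heatExtension (fun y => ‖v y‖ ^ 2) s x := by
    rw [heatExtension_apply, heatExtension_apply]
    have hgc : Continuous fun y : E3 => ‖v y‖ ^ 2 := by fun_prop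
    have hgb : ∀ z : E3, ‖(fun y : E3 => ‖v y‖ ^ 2) z‖ ≤ M ^ 2 := fun z => by
      rw [Real.norm_of_nonneg (sq_nonneg _)]
      exact pow_le_pow_left₀ (norm_nonneg _) (hM z) 2
    have hgi := integrable_heatKernel_smul_of_bound hgc hgb hs x
    refine integral_mono_of_nonneg (Eventually.of_forall fun z => ?_) hgi
      (Eventually.of_forall fun z => ?_)
    · exact smul_nonneg (heatKernel_pos hs z).le (sq_nonneg _)
    · refine smul_le_smul_of_nonneg_left ?_ (heatKernel_pos hs z).le
      have h := PiLp.norm_apply_le (v (x - z)) i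
      rw [Real.norm_eq_abs] at h
      calc v (x - z) i ^ 2 = |v (x - z) i| ^ 2 := (sq_abs _).symm
        _ ≤ ‖v (x - z)‖ ^ 2 := pow_le_pow_left₀ (abs_nonneg _) h 2
  unfold cVar
  nlinarith [sq_nonneg (heatExtension (fun y => v y i) s x)]

/-- **LARGE-SCALE LAW.** For every `C` there is `L₂ = L₂(C) ≥ 0` with `s · sgVar (u t) s x ≤ L₂`
for all `u ∈ A_C`, `t < 0`, `s > 0`, `x`: `sgVar ≤ 3 e^{sΔ}|u(t)|²(x)`, and the windowed energy
`s · e^{sΔ}|u(t)|²(x)` is bounded on the class by the far-past ledger transported to heat time `1`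
(translation by `x`, parabolic rescaling by `√s`) and the unit-scale Gaussian energy bound. -/
theorem large_law (C : ℝ) : ∃ L : ℝ, 0 ≤ L ∧ ∀ u : ℝ → E3 → E3, IsTypeIAncientMild C u →
    ∀ t < 0, ∀ s : ℝ, 0 < s → ∀ x : E3, s * sgVar (u t) s x ≤ L := by
  obtain ⟨K, hK0, hK⟩ := ledger_unitBall C
  obtain ⟨Cg, hCgtop, hCg⟩ := exists_gauss_unit_sq_bound
  have hCKtop : Cg * ENNReal.ofReal K ≠ ⊤ := ENNReal.mul_ne_top hCgtop ENNReal.ofReal_ne_top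
  refine ⟨3 * (Cg * ENNReal.ofReal K).toReal, by positivity, fun u hu t ht s hs x => ?_⟩
  set c : ℝ := Real.sqrt s with hc
  have hc0 : 0 < c := Real.sqrt_pos.2 hs
  have hcc : c ^ 2 = s := Real.sq_sqrt hs.le
  set w : ℝ → E3 → E3 := FluidPDE.nsRescale c (fun t' z => u t' (z + x)) with hw
  have hw_mem : IsTypeIAncientMild C w := (hu.comp_add_right x).nsRescale hc0
  have hts : t / s < 0 := div_neg_of_neg_of_pos ht hs
  have hcont : Continuous (u t) := hu.continuous_slice ht
  have hM : ∀ z, ‖u t z‖ ≤ C / Real.sqrt (-t) := fun z => hu.norm_le ht z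
  -- the pointwise identity behind the change of variables
  have hpt : ∀ z : E3, heatKernel 1 z • ‖u t (x + c • z)‖ ^ 2 =
      s⁻¹ * (heatKernel 1 z * ‖w (t / s) z‖ ^ 2) := by
    intro z
    have h1 : w (t / s) z = c • u t (x + c • z) := by
      simp only [hw, nsRescale_apply]
      rw [hcc, mul_div_cancel₀ t hs.ne', add_comm]
    rw [h1, norm_smul, Real.norm_of_nonneg hc0.le, mul_pow, hcc, smul_eq_mul]
    field_simp
  -- representation of the windowed energy through the rescaled, translated, reflected element
  have hrep : heatExtension (fun y => ‖u t y‖ ^ 2) s x =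
      s⁻¹ * ∫ z, heatKernel 1 z * ‖w (t / s) z‖ ^ 2 := by
    rw [heatExtension_eq_integral_heatKernel_one hs]
    have hflip : ∫ z : E3, heatKernel 1 z • ‖u t (x - c • z)‖ ^ 2 =
        ∫ z : E3, heatKernel 1 z • ‖u t (x + c • z)‖ ^ 2 := by
      rw [← integral_neg_eq_self (fun z : E3 => heatKernel 1 z • ‖u t (x + c • z)‖ ^ 2) volume]
      refine integral_congr_ae (Eventually.of_forall fun z => ?_)
      simp only [heatKernel_neg, smul_neg, sub_eq_add_neg]
    rw [hflip, ← integral_const_mul]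
    exact integral_congr_ae (Eventually.of_forall hpt)
  -- the unit-scale bound for the class element `w` at the time `t/s < 0`
  have hwm : AEStronglyMeasurable (w (t / s)) volume := hw_mem.aestronglyMeasurable_slice hts
  have hwA : ∀ z : E3, ∫⁻ y in ball z 1, ‖w (t / s) y‖ₑ ^ 2 ≤ ENNReal.ofReal K :=
    fun z => hK w hw_mem (t / s) hts z
  have hI : ∫ z, heatKernel 1 z * ‖w (t / s) z‖ ^ 2 ≤ (Cg * ENNReal.ofReal K).toReal := by
    refine (le_abs_self _).trans ?_
    rw [← Real.norm_eq_abs]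
    refine (norm_integral_le_lintegral_norm _).trans (ENNReal.toReal_mono hCKtop ?_)
    have := hCg (w (t / s)) hwm (ENNReal.ofReal K) hwA
    simpa only [ofReal_norm] using this
  -- `sgVar ≤ 3 e^{sΔ}|u|²`
  have h3 : sgVar (u t) s x ≤ 3 * heatExtension (fun y => ‖u t y‖ ^ 2) s x := by
    calc sgVar (u t) s x = ∑ i : Fin 3, cVar (fun z => u t z i) s x := rfl
      _ ≤ ∑ _i : Fin 3, heatExtension (fun y => ‖u t y‖ ^ 2) s x :=
          Finset.sum_le_sum fun i _ => cVar_apply_le_heatExtension_norm_sq hcont hM hs i x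
      _ = 3 * heatExtension (fun y => ‖u t y‖ ^ 2) s x := by
          simp only [Finset.sum_const, Finset.card_univ, Fintype.card_fin, nsmul_eq_mul]
          push_cast; ring
  calc s * sgVar (u t) s x ≤ s * (3 * heatExtension (fun y => ‖u t y‖ ^ 2) s x) :=
        mul_le_mul_of_nonneg_left h3 hs.le
    _ = 3 * ∫ z, heatKernel 1 z * ‖w (t / s) z‖ ^ 2 := by rw [hrep]; field_simp
    _ ≤ 3 * (Cg * ENNReal.ofReal K).toReal := by gcongr

/-! ## I. Rows (census block A2) -/

/-- **Row A2kp (METER READING, pointwise; PROVED `row_A2kp`).** -/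
def Row_A2kp : Prop :=
  ∀ C : ℝ, ∃ θ : ℝ, 0 < θ ∧ ∀ u : ℝ → E3 → E3, IsTypeIAncientMild C u → ∀ t < 0, ∀ x : E3,
    (-t) * sgVar (u t) (θ * (-t)) x ≤ θ / 72 → (-t) * ‖fderiv ℝ (u t) x‖ ≤ 1 / 2

/-- **Row A2k1 (subgrid-energy cell at a C-dependent relative scale, universal threshold θ/72;
PROVED `row_A2k1`).**  A Type-I ancient mild field whose scale-invariant subgrid kinetic energy
`(−t)·sgVar (u t) (θ(−t))` is `≤ θ/72` everywhere, for the scale `θ = θ(C)`, vanishes. -/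
def Row_A2k1 : Prop :=
  ∀ C : ℝ, ∃ θ : ℝ, 0 < θ ∧ ∀ u : ℝ → E3 → E3, IsTypeIAncientMild C u →
    (∀ t < 0, ∀ x : E3, (-t) * sgVar (u t) (θ * (-t)) x ≤ θ / 72) → ∀ t < 0, ∀ x, u t x = 0

/-- **Row A2kb (the same on a backward end `t < T`, `T ≤ 0`; PROVED `row_A2kb`).** -/
def Row_A2kb : Prop :=
  ∀ C : ℝ, ∃ θ : ℝ, 0 < θ ∧ ∀ u : ℝ → E3 → E3, IsTypeIAncientMild C u → ∀ T ≤ (0 : ℝ),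
    (∀ t < T, ∀ x : E3, (-t) * sgVar (u t) (θ * (-t)) x ≤ θ / 72) → ∀ t < 0, ∀ x, u t x = 0

/-- **Row A2k0 (plain thresholds `∀C ∃θ ∃δ`; PROVED `row_A2k0`).** -/
def Row_A2k0 : Prop :=
  ∀ C : ℝ, ∃ θ : ℝ, 0 < θ ∧ ∃ δ : ℝ, 0 < δ ∧ ∀ u : ℝ → E3 → E3, IsTypeIAncientMild C u →
    (∀ t < 0, ∀ x : E3, (-t) * sgVar (u t) (θ * (-t)) x ≤ δ) → ∀ t < 0, ∀ x, u t x = 0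

/-- **Row A2kf (FINE-SCALE LAW, structural; PROVED `row_A2kf`).** -/
def Row_A2kf : Prop :=
  ∀ C : ℝ, ∃ F : ℝ, 0 ≤ F ∧ ∀ u : ℝ → E3 → E3, IsTypeIAncientMild C u → ∀ t < 0, ∀ s : ℝ,
    0 < s → ∀ x : E3, (-t) ^ 2 * sgVar (u t) s x ≤ F * s

/-- **Row A2kl (LARGE-SCALE LAW, structural; PROVED `row_A2kl`).** -/
def Row_A2kl : Prop :=
  ∀ C : ℝ, ∃ L : ℝ, 0 ≤ L ∧ ∀ u : ℝ → E3 → E3, IsTypeIAncientMild C u → ∀ t < 0, ∀ s : ℝ,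
    0 < s → ∀ x : E3, s * sgVar (u t) s x ≤ L

/-- **Row A2kP (PARABOLIC scale `θ = 1`, C-dependent threshold) — OPEN, typed only.**  Not reached
by the reverse-Poincaré lever (the subgrid strain at `θ = 1` is of full gauge size `6K₂`). -/
@[conjecture] def Row_A2kP : Prop :=
  ∀ C : ℝ, ∃ δ : ℝ, 0 < δ ∧ ∀ u : ℝ → E3 → E3, IsTypeIAncientMild C u →
    (∀ t < 0, ∀ x : E3, (-t) * sgVar (u t) (-t) x ≤ δ) → ∀ t < 0, ∀ x, u t x = 0

/-- **Row A2kU (UNIVERSAL scale and threshold) — OPEN, typed only.**  By the large-scale law the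
hypothesis is automatic on `A_C` once `L₂(C) ≤ δθ`; for large `C` it is a genuine restriction. -/
@[conjecture] def Row_A2kU : Prop :=
  ∃ θ : ℝ, 0 < θ ∧ ∃ δ : ℝ, 0 < δ ∧ ∀ (C : ℝ) (u : ℝ → E3 → E3), IsTypeIAncientMild C u →
    (∀ t < 0, ∀ x : E3, (-t) * sgVar (u t) (θ * (-t)) x ≤ δ) → ∀ t < 0, ∀ x, u t x = 0

/-! ## J. Verdicts -/

/-- **Row A2kp holds.** -/
theorem row_A2kp : Row_A2kp := fun C => by
  obtain ⟨θ₀, hθ₀, h⟩ := strain_le_half_of_sgVar C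
  exact ⟨θ₀, hθ₀, fun u hu t ht x hv => h u hu θ₀ hθ₀ le_rfl t ht x hv⟩

/-- **Row A2kb holds.** -/
theorem row_A2kb : Row_A2kb := fun C => by
  obtain ⟨θ₀, hθ₀, h⟩ := strain_le_half_of_sgVar C
  refine ⟨θ₀, hθ₀, fun u hu T hT hv => ?_⟩
  exact eq_zero_of_strain_le_half_before hu hT
    (fun t ht x => h u hu θ₀ hθ₀ le_rfl t (by linarith) x (hv t ht x))

/-- Nesting: the backward-end cell gives the all-times cell. -/
theorem row_A2kb_imp_A2k1 : Row_A2kb → Row_A2k1 := fun h C => by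
  obtain ⟨θ, hθ, hrow⟩ := h C
  exact ⟨θ, hθ, fun u hu hv => hrow u hu 0 le_rfl hv⟩

/-- **Row A2k1 holds.** -/
theorem row_A2k1 : Row_A2k1 := row_A2kb_imp_A2k1 row_A2kb

/-- **Row A2k0 holds.** -/
theorem row_A2k0 : Row_A2k0 := fun C => by
  obtain ⟨θ, hθ, h⟩ := row_A2k1 C
  exact ⟨θ, hθ, θ / 72, by positivity, h⟩

/-- **Row A2kf holds** (fine-scale law). -/
theorem row_A2kf : Row_A2kf := fine_law

/-- **Row A2kl holds** (large-scale law). -/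
theorem row_A2kl : Row_A2kl := large_law

/-- Nesting: the universal cell gives the plain thresholds. -/
theorem row_A2kU_imp_A2k0 : Row_A2kU → Row_A2k0 := fun ⟨θ, hθ, δ, hδ, h⟩ C =>
  ⟨θ, hθ, δ, hδ, h C⟩

/-- (L′) decides every cell of this line (the rows are weakenings of the rung). -/
theorem rows_of_L' (hL : ∀ (C : ℝ) (u : ℝ → E3 → E3), IsTypeIAncientMild C u →
    ∀ t < 0, ∀ x, u t x = 0) : Row_A2kP ∧ Row_A2kU :=
  ⟨fun C => ⟨1, one_pos, fun u hu _ => hL C u hu⟩,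
    ⟨1, one_pos, 1, one_pos, fun C u hu _ => hL C u hu⟩⟩

end Summit.NavierStokesRegularity.NavierStokesRegularity.Theorems.ScenarioCensus.SubgridMeter

namespace Summit.NavierStokesRegularity.NavierStokesRegularity.Theorems.ScenarioCensus

/-! ## Census KEYS (ns `…Theorems.ScenarioCensus`): instrument SUBGRID METER (block A2) — TREE-decided cells A2kp / A2k1 / A2kb / A2k0 and laws A2kf / A2kl, OPEN rows A2kP / A2kU -/

/-- **Cell A2kp** (meter reading, pointwise): `:= SubgridMeter.Row_A2kp`. DECIDED. -/
def Row_A2kp : Prop := SubgridMeter.Row_A2kp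
/-- A2kp is EXCLUDED (decided in the tree): `SubgridMeter.row_A2kp`. -/
theorem row_A2kp_excluded : Row_A2kp := SubgridMeter.row_A2kp

/-- **Cell A2k1** (subgrid-energy cell at a `C`-dependent relative scale, threshold `θ/72` ⇒ `u ≡ 0`): `:= SubgridMeter.Row_A2k1`. DECIDED. -/
def Row_A2k1 : Prop := SubgridMeter.Row_A2k1
/-- A2k1 is EXCLUDED (decided in the tree): `SubgridMeter.row_A2k1`. -/
theorem row_A2k1_excluded : Row_A2k1 := SubgridMeter.row_A2k1

/-- **Cell A2kb** (the same on a backward end): `:= SubgridMeter.Row_A2kb`. DECIDED. -/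
def Row_A2kb : Prop := SubgridMeter.Row_A2kb
/-- A2kb is EXCLUDED (decided in the tree): `SubgridMeter.row_A2kb`. -/
theorem row_A2kb_excluded : Row_A2kb := SubgridMeter.row_A2kb

/-- **Cell A2k0** (plain thresholds `∀C ∃θ ∃δ`): `:= SubgridMeter.Row_A2k0`. DECIDED. -/
def Row_A2k0 : Prop := SubgridMeter.Row_A2k0
/-- A2k0 is EXCLUDED (decided in the tree): `SubgridMeter.row_A2k0`. -/
theorem row_A2k0_excluded : Row_A2k0 := SubgridMeter.row_A2k0

/-- **Cell A2kf** (fine-scale law, structural): `:= SubgridMeter.Row_A2kf`. DECIDED. -/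
def Row_A2kf : Prop := SubgridMeter.Row_A2kf
/-- A2kf is EXCLUDED (decided in the tree): `SubgridMeter.row_A2kf`. -/
theorem row_A2kf_excluded : Row_A2kf := SubgridMeter.row_A2kf

/-- **Cell A2kl** (large-scale law, structural): `:= SubgridMeter.Row_A2kl`. DECIDED. -/
def Row_A2kl : Prop := SubgridMeter.Row_A2kl
/-- A2kl is EXCLUDED (decided in the tree): `SubgridMeter.row_A2kl`. -/
theorem row_A2kl_excluded : Row_A2kl := SubgridMeter.row_A2kl

/-- **Row A2kP** (parabolic scale `θ = 1`, `C`-dependent threshold) — typed only: `:= SubgridMeter.Row_A2kP`. OPEN (no witness, no proof). -/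
@[conjecture] def Row_A2kP : Prop := SubgridMeter.Row_A2kP

/-- **Row A2kU** (universal scale and threshold) — typed only: `:= SubgridMeter.Row_A2kU`. OPEN (no witness, no proof). -/
@[conjecture] def Row_A2kU : Prop := SubgridMeter.Row_A2kU

/-- Lattice edge at key level: A2kb implies A2k1 (`SubgridMeter.row_A2kb_imp_A2k1`). -/
theorem row_A2k1_of_row_A2kb : Row_A2kb → Row_A2k1 := SubgridMeter.row_A2kb_imp_A2k1
/-- Lattice edge at key level: A2kU implies A2k0 (`SubgridMeter.row_A2kU_imp_A2k0`). -/
theorem row_A2k0_of_row_A2kU : Row_A2kU → Row_A2k0 := SubgridMeter.row_A2kU_imp_A2k0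

end Summit.NavierStokesRegularity.NavierStokesRegularity.Theorems.ScenarioCensus

end
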